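import Mathlib
import Literature.LinearAlgebra.Matrix.VarahSingularValueBound
import Literature.LinearAlgebra.Matrix.BauerFike
import HarnessLib

/-!
# Varga's H-matrix form of Varah's bounds: `‖A⁻¹‖_∞ ≤ ‖u‖_∞ / δ`, `σ_min(A)` under scaling

Topic `Literature/LinearAlgebra/Matrix`; support file (everything PROVED; no definitions; no named
facts). Sub-namespace `Varah`, continuing `…Matrix.VarahBound` (`‖A⁻¹‖_∞ ≤ 1/α` for strictly
diagonally dominant `A`) and `…Matrix.VarahSingularValueBound` (`σ_min(A) ≥ √(α β)`), which are
the case `u = v = (1, …, 1)` of this file. Norms as there: the row/column-sum and componentwise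
statements are norm-free; `‖A⁻¹‖_∞` is the `ℓ∞` operator norm (`Matrix.Norms.Operator`),
`‖A⁻¹‖₂` the spectral norm (`Matrix.Norms.L2Operator`); `‖u‖` for a real vector is the sup norm.

THE RESULT. Varga's generalisation of Varah's Theorems A and B from strictly diagonally dominant
matrices to nonsingular H-matrices [Varga1976MMatrixTheory, §4 Thm 2 (4.7), Thm 3 (4.8)] (proofs
in [Varga1976]): with the comparison matrix `𝓜(A)` (`|aᵢᵢ|` on the diagonal, `−|aᵢⱼ|` off it)
and any positive vector `u` with `𝓜(A) u > 0`, `‖u‖_∞ = 1`, `f_A(u) := minᵢ (𝓜(A) u)ᵢ`,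
  (4.7) `sup_{B ∈ Ω_A} ‖B⁻¹‖_∞ = ‖𝓜(A)⁻¹‖_∞ = 1 / max_u f_A(u)`, in particular
        `‖A⁻¹‖_∞ ≤ 1 / f_A(u)` for every admissible `u`;
  (4.8) `σ_n(A) ≥ {f_A(u) · f_{Aᵀ}(v)}^{1/2}` for admissible `u` (rows) and `v` (columns).
We type the INEQUALITIES (the parts a verifier uses), with unnormalised scaling vectors: the
hypothesis "`𝓜(A) u ≥ δ`" is written row by row as `δ + Σ_{j ≠ i} ‖aᵢⱼ‖ uⱼ ≤ ‖aᵢᵢ‖ uᵢ`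
(generalised / scaled diagonal dominance: `A · diag(u)` is strictly diagonally dominant).

* NONSINGULARITY from a scaled margin (`isUnit_det_of_scaled_margin`).
* ROW SUMS OF THE INVERSE, sharp per-row form `Σⱼ ‖(A⁻¹)ᵢⱼ‖ ≤ uᵢ δ⁻¹`
  (`sum_norm_inv_row_le_of_scaled_margin`; from `A⁻¹ = diag(u) (A diag(u))⁻¹` and the unscaled
  file), COLUMN SUMS `Σᵢ ‖(A⁻¹)ᵢⱼ‖ ≤ vⱼ ε⁻¹` under `𝓜(Aᵀ) v ≥ ε`
  (`sum_norm_inv_col_le_of_scaled_margin`).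
* VARGA'S BOUND `‖A⁻¹‖_∞ ≤ ‖u‖_∞ δ⁻¹` (`linfty_norm_inv_le_of_scaled_margin`, = (4.7)'s inequality
  after normalising `‖u‖_∞ = 1`) and the COMPONENTWISE ENCLOSURE `‖xᵢ‖ ≤ uᵢ δ⁻¹ ‖A x‖_∞`
  (`norm_apply_le_scaled_of_margin`) — the form in which a verifier encloses `A⁻¹ b` componentwise
  from an approximate positive solution `u` of `𝓜(A) u ≈ (1, …, 1)` without inverting `A`
  (Neumaier's `A⁻¹ b ∈ ‖b‖ δ⁻¹ [−u, u]`-type bound, here for point data).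
* VARGA'S SINGULAR-VALUE BOUND `‖A⁻¹‖₂ ≤ √((‖u‖_∞ δ⁻¹)(‖v‖_∞ ε⁻¹))`, i.e.
  `σ_min(A) ≥ √(δ ε / (‖u‖_∞ ‖v‖_∞))` (`l2_norm_inv_le_of_scaled_margins`, via the row/column sums
  and the Schur test `Varah.l2_norm_le_sqrt_of_rowSum_colSum`), with the vector form
  `‖x‖₂ ≤ √(…) ‖A x‖₂` (`l2_norm_le_scaled_mul_norm_mulVec`).

RELATION TO THE TREE (dedup). Not a restatement of anything landed: `…Matrix.VarahBound` /
`…Matrix.VarahSingularValueBound` are the unscaled case `u = v = 1` (used here, not re-proved);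
`Literature.Analysis.ValidatedNumerics.IntervalLinearSystems` types Neumaier's Ch. 4 bounds
"specialised to the unscaled maximum norm (`u = e`)" and lists H-matrices / `⟨A⟩u ≥ ν` as not
formalised — the scaled point-matrix inequalities here are exactly that missing case for point data;
`…DiagonallyDominantMaximalVolume`, `…InverseMMatrix` concern different statements (entrywise
dominance of `A⁻¹`; inverse M-matrices / potentials). Mathlib has no H-matrix notion; none is
introduced (the hypothesis is stated row by row).

NOT TYPED here: the EQUALITIES in (4.7) (`sup_{B ∈ Ω_A} ‖B⁻¹‖_∞ = ‖𝓜(A)⁻¹‖_∞`, attained at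
`u = 𝓜(A)⁻¹ ζ / ‖𝓜(A)⁻¹ ζ‖_∞`), the equivalence "nonsingular H-matrix ⇔ `U_A ≠ ∅`"
(ibid. Thm 1 i) ⇔ ii)),
and interval-matrix versions.

References:
* R. S. Varga, *M-matrix theory and recent results in numerical linear algebra*, in: Sparse Matrix
  Computations (J. R. Bunch, D. J. Rose, eds.), Academic Press, 1976, §4 "On bounding ‖A⁻¹‖_∞",
  (4.5)–(4.8), Theorems 2 and 3, p. 265–266. [Varga1976MMatrixTheory]
* R. S. Varga, *On diagonal dominance arguments for bounding ‖A⁻¹‖_∞*, Linear Algebra Appl. 14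
  (1976) 211–217. [Varga1976]
* J. M. Varah, *A lower bound for the smallest singular value of a matrix*, Linear Algebra Appl. 11
  (1975) 3–5. [Varah1975]
-/

open Matrix WithLp

namespace Literature.LinearAlgebra.Matrix.Varah

/-- A component of a real vector is at most its sup norm. [folklore] -/
private theorem apply_le_pi_norm {ι : Type*} [Fintype ι] (u : ι → ℝ) (i : ι) : u i ≤ ‖u‖ :=
  (le_abs_self _).trans (by simpa only [Real.norm_eq_abs] using norm_le_pi_norm u i)

/-! ### Scaled row dominance: `‖A⁻¹‖_∞ ≤ ‖u‖_∞ / δ` -/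

section ScaledInf

open scoped _root_.Matrix.Norms.Operator

variable {K : Type*} [NontriviallyNormedField K] [NormedAlgebra ℝ K] {n : Type*} [Fintype n]
  [DecidableEq n]

omit [DecidableEq n] in
/-- Entries of `A · diag(u)` have norms `‖aᵢⱼ‖ uⱼ` for a positive real scaling vector `u`.
[folklore] -/
private theorem norm_mul_diagonal_algebraMap [DecidableEq n] (A : Matrix n n K) {u : n → ℝ}
    (hu : ∀ i, 0 < u i) (i j : n) :
    ‖(A * diagonal fun k => algebraMap ℝ K (u k)) i j‖ = ‖A i j‖ * u j := by
  rw [mul_diagonal, norm_mul, norm_algebraMap', Real.norm_eq_abs, abs_of_pos (hu j)]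

/-- The scaled margin hypothesis says exactly that `A · diag(u)` has (unscaled) row margin `δ`.
[folklore] -/
private theorem margin_mul_diagonal {A : Matrix n n K} {u : n → ℝ} {δ : ℝ} (hu : ∀ i, 0 < u i)
    (h : ∀ i, δ + ∑ j ∈ Finset.univ.erase i, ‖A i j‖ * u j ≤ ‖A i i‖ * u i) (i : n) :
    δ + ∑ j ∈ Finset.univ.erase i, ‖(A * diagonal fun k => algebraMap ℝ K (u k)) i j‖ ≤
      ‖(A * diagonal fun k => algebraMap ℝ K (u k)) i i‖ := by
  simpa only [norm_mul_diagonal_algebraMap A hu] using h i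

/-- The diagonal scaling matrix of a positive vector is invertible. [folklore] -/
private theorem isUnit_det_diagonal_algebraMap {u : n → ℝ} (hu : ∀ i, 0 < u i) :
    IsUnit (diagonal fun k => algebraMap ℝ K (u k)).det := by
  rw [det_diagonal, isUnit_iff_ne_zero, Finset.prod_ne_zero_iff]
  intro i _
  exact (map_ne_zero (algebraMap ℝ K)).2 (hu i).ne'

/-- `A⁻¹ = diag(u) · (A · diag(u))⁻¹`. [folklore] -/
private theorem inv_eq_diagonal_mul_inv {A : Matrix n n K} {u : n → ℝ} (hu : ∀ i, 0 < u i) :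
    A⁻¹ = (diagonal fun k => algebraMap ℝ K (u k)) *
      (A * diagonal fun k => algebraMap ℝ K (u k))⁻¹ := by
  rw [Matrix.mul_inv_rev, ← mul_assoc, mul_nonsing_inv _ (isUnit_det_diagonal_algebraMap hu),
    one_mul]

/-- **Generalised (scaled) diagonal dominance ⇒ nonsingular**: if for a positive vector `u` and
`δ > 0` every row satisfies `δ + Σ_{j ≠ i} ‖aᵢⱼ‖ uⱼ ≤ ‖aᵢᵢ‖ uᵢ` (i.e. `𝓜(A) u ≥ δ > 0`, `A` is a
nonsingular H-matrix with scaling vector `u`), then `A` is invertible.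
[cite: Varga1976MMatrixTheory, Thm 1 i) ⇔ ii), §4 (4.5)] -/
theorem isUnit_det_of_scaled_margin {A : Matrix n n K} {u : n → ℝ} {δ : ℝ} (hu : ∀ i, 0 < u i)
    (hδ : 0 < δ) (h : ∀ i, δ + ∑ j ∈ Finset.univ.erase i, ‖A i j‖ * u j ≤ ‖A i i‖ * u i) :
    IsUnit A.det := by
  have h1 : IsUnit (A * diagonal fun k => algebraMap ℝ K (u k)).det :=
    isUnit_det_of_margin hδ (margin_mul_diagonal hu h)
  rw [det_mul] at h1
  exact (IsUnit.mul_iff.mp h1).1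

/-- **Row sums of the inverse under scaling**: with `𝓜(A) u ≥ δ > 0` as above,
`Σⱼ ‖(A⁻¹)ᵢⱼ‖ ≤ uᵢ / δ` for every row `i` (row `i` of `A⁻¹ = diag(u) (A diag(u))⁻¹` is `uᵢ` times
a row of an inverse with unscaled margin `δ`). [cite: Varga1976MMatrixTheory, §4 Thm 2 (4.7)] -/
theorem sum_norm_inv_row_le_of_scaled_margin {A : Matrix n n K} {u : n → ℝ} {δ : ℝ}
    (hu : ∀ i, 0 < u i) (hδ : 0 < δ)
    (h : ∀ i, δ + ∑ j ∈ Finset.univ.erase i, ‖A i j‖ * u j ≤ ‖A i i‖ * u i) (i : n) :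
    ∑ j, ‖A⁻¹ i j‖ ≤ u i * δ⁻¹ := by
  have h1 := sum_norm_inv_row_le_of_margin hδ (margin_mul_diagonal hu h) i
  rw [inv_eq_diagonal_mul_inv hu]
  simp only [diagonal_mul, norm_mul, norm_algebraMap', Real.norm_eq_abs, abs_of_pos (hu i),
    ← Finset.mul_sum]
  exact mul_le_mul_of_nonneg_left h1 (hu i).le

/-- **Varga's H-matrix bound** (the inequality of Thm 2 (4.7), `‖A⁻¹‖_∞ ≤ ‖u‖_∞ / f_A(u)` for any
positive `u` with `𝓜(A) u > 0`): with `𝓜(A) u ≥ δ > 0`, `A` is invertible and `‖A⁻¹‖_∞ ≤ ‖u‖_∞ δ⁻¹`.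
For `u = (1, …, 1)` this is Varah's bound `VarahBound.linfty_norm_inv_le_of_margin`.
[cite: Varga1976MMatrixTheory, §4 Thm 2 (4.7)] [cite: Varga1976] -/
theorem linfty_norm_inv_le_of_scaled_margin {A : Matrix n n K} {u : n → ℝ} {δ : ℝ}
    (hu : ∀ i, 0 < u i) (hδ : 0 < δ)
    (h : ∀ i, δ + ∑ j ∈ Finset.univ.erase i, ‖A i j‖ * u j ≤ ‖A i i‖ * u i) :
    IsUnit A.det ∧ ‖A⁻¹‖ ≤ ‖u‖ * δ⁻¹ := by
  refine ⟨isUnit_det_of_scaled_margin hu hδ h, ?_⟩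
  refine BauerFike.linfty_opNorm_le_of_row_sum_le (by positivity) fun i => ?_
  exact (sum_norm_inv_row_le_of_scaled_margin hu hδ h i).trans
    (mul_le_mul_of_nonneg_right (apply_le_pi_norm u i) (inv_nonneg.2 hδ.le))

/-- **Componentwise enclosure** (the form a verifier uses, cf. Neumaier's `|A⁻¹ b| ≤ ‖b‖ δ⁻¹ u`):
with `𝓜(A) u ≥ δ > 0`, every component of `x` satisfies `‖xᵢ‖ ≤ uᵢ δ⁻¹ ‖A x‖_∞`.
[cite: Varga1976MMatrixTheory, §4 Thm 2 (4.7)] -/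
theorem norm_apply_le_scaled_of_margin {A : Matrix n n K} {u : n → ℝ} {δ : ℝ}
    (hu : ∀ i, 0 < u i) (hδ : 0 < δ)
    (h : ∀ i, δ + ∑ j ∈ Finset.univ.erase i, ‖A i j‖ * u j ≤ ‖A i i‖ * u i) (x : n → K)
    (i : n) : ‖x i‖ ≤ u i * δ⁻¹ * ‖A *ᵥ x‖ := by
  have hU := isUnit_det_of_scaled_margin hu hδ h
  have hx : x i = ∑ j, A⁻¹ i j * (A *ᵥ x) j := by
    conv_lhs => rw [← one_mulVec x, ← nonsing_inv_mul A hU, ← mulVec_mulVec]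
    rfl
  rw [hx]
  calc ‖∑ j, A⁻¹ i j * (A *ᵥ x) j‖ ≤ ∑ j, ‖A⁻¹ i j‖ * ‖A *ᵥ x‖ := by
        refine (norm_sum_le _ _).trans (Finset.sum_le_sum fun j _ => ?_)
        rw [norm_mul]
        exact mul_le_mul_of_nonneg_left (norm_le_pi_norm _ j) (norm_nonneg _)
    _ = (∑ j, ‖A⁻¹ i j‖) * ‖A *ᵥ x‖ := by rw [Finset.sum_mul]
    _ ≤ u i * δ⁻¹ * ‖A *ᵥ x‖ :=
        mul_le_mul_of_nonneg_right (sum_norm_inv_row_le_of_scaled_margin hu hδ h i)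
          (norm_nonneg _)

/-- **Column sums of the inverse under scaling**: if for a positive vector `v` and `ε > 0` every
column satisfies `ε + Σ_{i ≠ j} ‖aᵢⱼ‖ vᵢ ≤ ‖aⱼⱼ‖ vⱼ` (`𝓜(Aᵀ) v ≥ ε`), then
`Σᵢ ‖(A⁻¹)ᵢⱼ‖ ≤ vⱼ / ε` for every column `j`. [cite: Varga1976MMatrixTheory, §4 Thm 3 (4.8)] -/
theorem sum_norm_inv_col_le_of_scaled_margin {A : Matrix n n K} {v : n → ℝ} {ε : ℝ}
    (hv : ∀ i, 0 < v i) (hε : 0 < ε)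
    (h : ∀ j, ε + ∑ i ∈ Finset.univ.erase j, ‖A i j‖ * v i ≤ ‖A j j‖ * v j) (j : n) :
    ∑ i, ‖A⁻¹ i j‖ ≤ v j * ε⁻¹ := by
  have h1 := sum_norm_inv_row_le_of_scaled_margin (A := Aᵀ) hv hε
    (fun i => by simpa only [transpose_apply] using h i) j
  simpa only [← transpose_nonsing_inv, transpose_apply] using h1

end ScaledInf

/-! ### Scaled row and column dominance: `σ_min(A) ≥ √(δ ε / (‖u‖_∞ ‖v‖_∞))` -/

section ScaledL2

open scoped _root_.Matrix.Norms.L2Operator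

variable {K : Type*} [RCLike K] {n : Type*} [Fintype n] [DecidableEq n]

/-- **Varga's H-matrix singular-value bound** (Thm 3 (4.8): `σ_n(A) ≥ √(f_A(u) f_{Aᵀ}(v))`,
here with unnormalised scaling vectors): if `𝓜(A) u ≥ δ > 0` (rows, positive `u`) and
`𝓜(Aᵀ) v ≥ ε > 0` (columns, positive `v`), then `A` is invertible and
`‖A⁻¹‖₂ ≤ √((‖u‖_∞ δ⁻¹) (‖v‖_∞ ε⁻¹))`. For `u = v = (1, …, 1)` this is Varah's `σ_min ≥ √(α β)`
(`l2_norm_inv_le_of_margins`). [cite: Varga1976MMatrixTheory, §4 Thm 3 (4.8)] -/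
theorem l2_norm_inv_le_of_scaled_margins {A : Matrix n n K} {u v : n → ℝ} {δ ε : ℝ}
    (hu : ∀ i, 0 < u i) (hδ : 0 < δ)
    (hrow : ∀ i, δ + ∑ j ∈ Finset.univ.erase i, ‖A i j‖ * u j ≤ ‖A i i‖ * u i)
    (hv : ∀ i, 0 < v i) (hε : 0 < ε)
    (hcol : ∀ j, ε + ∑ i ∈ Finset.univ.erase j, ‖A i j‖ * v i ≤ ‖A j j‖ * v j) :
    IsUnit A.det ∧ ‖A⁻¹‖ ≤ √(‖u‖ * δ⁻¹ * (‖v‖ * ε⁻¹)) := by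
  refine ⟨isUnit_det_of_scaled_margin hu hδ hrow, ?_⟩
  refine l2_norm_le_sqrt_of_rowSum_colSum A⁻¹ (fun i => ?_) (fun j => ?_)
  · exact (sum_norm_inv_row_le_of_scaled_margin hu hδ hrow i).trans
      (mul_le_mul_of_nonneg_right (apply_le_pi_norm u i) (inv_nonneg.2 hδ.le))
  · exact (sum_norm_inv_col_le_of_scaled_margin hv hε hcol j).trans
      (mul_le_mul_of_nonneg_right (apply_le_pi_norm v j) (inv_nonneg.2 hε.le))

/-- **Vector form**: under the hypotheses of `l2_norm_inv_le_of_scaled_margins`,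
`‖x‖₂ ≤ √((‖u‖_∞ δ⁻¹) (‖v‖_∞ ε⁻¹)) ‖A x‖₂` for every `x`.
[cite: Varga1976MMatrixTheory, §4 Thm 3 (4.8)] -/
theorem l2_norm_le_scaled_mul_norm_mulVec {A : Matrix n n K} {u v : n → ℝ} {δ ε : ℝ}
    (hu : ∀ i, 0 < u i) (hδ : 0 < δ)
    (hrow : ∀ i, δ + ∑ j ∈ Finset.univ.erase i, ‖A i j‖ * u j ≤ ‖A i i‖ * u i)
    (hv : ∀ i, 0 < v i) (hε : 0 < ε)
    (hcol : ∀ j, ε + ∑ i ∈ Finset.univ.erase j, ‖A i j‖ * v i ≤ ‖A j j‖ * v j)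
    (x : EuclideanSpace K n) :
    ‖x‖ ≤ √(‖u‖ * δ⁻¹ * (‖v‖ * ε⁻¹)) * ‖(toLp 2 (A *ᵥ x) : EuclideanSpace K n)‖ := by
  obtain ⟨hU, hinv⟩ := l2_norm_inv_le_of_scaled_margins hu hδ hrow hv hε hcol
  have h1 := l2_opNorm_mulVec A⁻¹ (toLp 2 (A *ᵥ x) : EuclideanSpace K n)
  rw [ofLp_toLp, mulVec_mulVec, nonsing_inv_mul A hU, one_mulVec, toLp_ofLp] at h1
  exact h1.trans (mul_le_mul_of_nonneg_right hinv (norm_nonneg _))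

end ScaledL2

end Literature.LinearAlgebra.Matrix.Varah
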